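import Summits.RiemannHypothesis.RiemannHypothesis.Theorems.PfPersistenceGalerkinFormAutocorr
import Summits.RiemannHypothesis.RiemannHypothesis.Theorems.PfPersistenceGalerkinFormDecay
import HarnessLib

/-!
# PF persistence — GAL-0 piece (ii), STEP 5a: dependence of the cut-off autocorrelation on the
# truncation RADIUS (pub-rhpf barrier-prover g2)

HONEST FRAMING: long-odds mechanism search; no RH claims.

For a `C¹` function `f : ℝ → ℂ` put `F_b := 1_{[-b,b]} f` (`cutoffAt b f`) and
`A_b := F_b ⋆ F̃_b` (`autocorrAt b f`).  PROVED here (RH-free), for radii `b ≥ 0`: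

* `weilMellin_cutoffAt_eq` — `F̂_b(s) = ∫_{-b}^{b} f(x) e^{(s-½)x} dx`; `weilMellin_autocorrAt` —
  `Â_b(s) = F̂_b(s) · conj F̂_b(1 - conj s)`;
* CONTINUITY IN THE RADIUS of `∫ ‖F_b‖²`, of the window values `A_b(x)`, of `F̂_b(s)`, hence of
  the prime term (a finite sum, uniformly for `b ≤ B`) and of the polar term of `W(A_b)`
  (`tendsto_integral_norm_sq_cutoffAt`, `tendsto_autocorrAt_apply`, `tendsto_weilPrimeTerm_autocorrAt`,
  `tendsto_weilPolarTerm_autocorrAt`);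
* `exists_norm_weilMellin_cutoffAt_half_le` — the IBP decay `‖F̂_b(½+it)‖ ≤ C_B/(1+|t|)`
  UNIFORMLY in `b ∈ [0, B]` (constants from `sup_{[-B,B]} ‖f‖`, `∫_{-B}^{B} ‖f‖`, `∫_{-B}^{B} ‖f'‖`).

The archimedean integral (dominated convergence with this uniform majorant) and the assembled
limit `W(A_{b_n}) → W(A_c)` are in `…GalerkinFormRadiusArch`.
-/

set_option linter.dupNamespace false

noncomputable section

open Complex Filter Set MeasureTheory Topology
open scoped Real ComplexConjugate

namespace Summit.RiemannHypothesis.RiemannHypothesis.Theorems.PfPersistence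

open Literature.NumberTheory.LFunctions

/-- The symmetric cut-off `F_b = 1_{[-b,b]} f`. -/
abbrev cutoffAt (b : ℝ) (f : ℝ → ℂ) : ℝ → ℂ := (Icc (-b) b).indicator f

/-- Its autocorrelation `A_b = F_b ⋆ F̃_b`. -/
abbrev autocorrAt (b : ℝ) (f : ℝ → ℂ) : ℝ → ℂ :=
  weilConv (cutoffAt b f) (weilReflect (cutoffAt b f))

variable {f f' : ℝ → ℂ}

/-! ## §1 The cut-off: reflection, integrability, Mellin transform, mass -/

/-- `(F_b)~ = 1_{[-b,b]} f̃`. [folklore] -/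
theorem weilReflect_cutoffAt (b : ℝ) (f : ℝ → ℂ) :
    weilReflect (cutoffAt b f) = cutoffAt b (weilReflect f) := by
  funext t
  simp only [weilReflect, cutoffAt]
  by_cases ht : t ∈ Icc (-b) b
  · have hnt : -t ∈ Icc (-b) b := ⟨by linarith [ht.2], by linarith [ht.1]⟩
    rw [indicator_of_mem ht, indicator_of_mem hnt]
    rfl
  · have hnt : -t ∉ Icc (-b) b := fun h ↦ ht ⟨by linarith [h.2], by linarith [h.1]⟩
    rw [indicator_of_notMem ht, indicator_of_notMem hnt, map_zero]

/-- `F_b · w` is integrable for continuous `f`, `w`. [folklore] -/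
theorem integrable_cutoffAt_mul (hfc : Continuous f) (b : ℝ) {w : ℝ → ℂ} (hw : Continuous w) :
    Integrable fun u : ℝ ↦ cutoffAt b f u * w u := by
  have h : (fun u : ℝ ↦ cutoffAt b f u * w u) = (Icc (-b) b).indicator (fun u ↦ f u * w u) := by
    funext u
    by_cases hu : u ∈ Icc (-b) b <;> simp [cutoffAt, hu]
  rw [h, integrable_indicator_iff measurableSet_Icc]
  exact (hfc.mul hw).continuousOn.integrableOn_Icc

/-- `F̂_b(s) = ∫_{-b}^{b} f(x) e^{(s-½)x} dx` (`b ≥ 0`). [folklore] -/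
theorem weilMellin_cutoffAt_eq (f : ℝ → ℂ) {b : ℝ} (hb : 0 ≤ b) (s : ℂ) :
    weilMellin (cutoffAt b f) s = ∫ x in (-b)..b, f x * cexp ((s - 1 / 2) * x) := by
  unfold weilMellin
  have hpt : (fun x : ℝ ↦ cutoffAt b f x * cexp ((s - 1 / 2) * x)) =
      (Icc (-b) b).indicator (fun x ↦ f x * cexp ((s - 1 / 2) * x)) := by
    funext x
    by_cases hx : x ∈ Icc (-b) b <;> simp [cutoffAt, hx]
  rw [hpt, MeasureTheory.integral_indicator measurableSet_Icc, integral_Icc_eq_integral_Ioc,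
    ← intervalIntegral.integral_of_le (by linarith)]

/-- `∫ ‖F_b‖² = ∫_{-b}^{b} ‖f‖²` (`b ≥ 0`). [folklore] -/
theorem integral_norm_sq_cutoffAt (f : ℝ → ℂ) {b : ℝ} (hb : 0 ≤ b) :
    ∫ t, ‖cutoffAt b f t‖ ^ 2 = ∫ t in (-b)..b, ‖f t‖ ^ 2 := by
  have hpt : (fun t : ℝ ↦ ‖cutoffAt b f t‖ ^ 2) = (Icc (-b) b).indicator (fun t ↦ ‖f t‖ ^ 2) := by
    funext t
    by_cases ht : t ∈ Icc (-b) b <;> simp [cutoffAt, ht]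
  rw [hpt, MeasureTheory.integral_indicator measurableSet_Icc, integral_Icc_eq_integral_Ioc,
    ← intervalIntegral.integral_of_le (by linarith)]

/-- `Â_b(s) = F̂_b(s) · conj F̂_b(1 - conj s)`. [folklore] -/
theorem weilMellin_autocorrAt (hfc : Continuous f) (b : ℝ) (s : ℂ) :
    weilMellin (autocorrAt b f) s =
      weilMellin (cutoffAt b f) s * conj (weilMellin (cutoffAt b f) (1 - conj s)) := by
  have hRc : Continuous (weilReflect f) := Complex.continuous_conj.comp (hfc.comp continuous_neg)
  have hH : Integrable fun u : ℝ ↦ weilReflect (cutoffAt b f) u * cexp ((s - 1 / 2) * u) := by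
    rw [weilReflect_cutoffAt]
    exact integrable_cutoffAt_mul hRc b (by fun_prop)
  rw [weilMellin_weilConv_of_integrable s (integrable_cutoffAt_mul hfc b (by fun_prop)) hH,
    weilMellin_weilReflect_holds]

/-! ## §2 Continuity in the radius -/

/-- `b ↦ ∫_{-b}^{b} h` is continuous for continuous `h`. [folklore] -/
theorem continuous_intervalIntegral_symm {E : Type*} [NormedAddCommGroup E] [NormedSpace ℝ E]
    [CompleteSpace E] {h : ℝ → E} (hh : Continuous h) :
    Continuous fun b : ℝ ↦ ∫ x in (-b)..b, h x := by
  have hP : Continuous fun y : ℝ ↦ ∫ x in (0 : ℝ)..y, h x :=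
    intervalIntegral.continuous_primitive (fun a b ↦ hh.intervalIntegrable a b) 0
  have heq : (fun b : ℝ ↦ ∫ x in (-b)..b, h x) =
      fun b ↦ (∫ x in (0 : ℝ)..b, h x) - ∫ x in (0 : ℝ)..(-b), h x := by
    funext b
    rw [intervalIntegral.integral_interval_sub_left (hh.intervalIntegrable _ _)
      (hh.intervalIntegrable _ _)]
  rw [heq]
  exact hP.sub (hP.comp continuous_neg)

/-- **Mass**: `∫ ‖F_{b_n}‖² → ∫ ‖F_c‖²` as `b_n → c` (`b_n, c ≥ 0`). [folklore] -/
theorem tendsto_integral_norm_sq_cutoffAt (hfc : Continuous f) {b : ℕ → ℝ} (hb : ∀ n, 0 ≤ b n)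
    {c : ℝ} (hc : 0 ≤ c) (hlim : Tendsto b atTop (𝓝 c)) :
    Tendsto (fun n ↦ ∫ t, ‖cutoffAt (b n) f t‖ ^ 2) atTop (𝓝 (∫ t, ‖cutoffAt c f t‖ ^ 2)) := by
  have h1 : (fun n ↦ ∫ t, ‖cutoffAt (b n) f t‖ ^ 2) = fun n ↦ ∫ t in (-(b n))..(b n), ‖f t‖ ^ 2 :=
    funext fun n ↦ integral_norm_sq_cutoffAt f (hb n)
  rw [h1, integral_norm_sq_cutoffAt f hc]
  exact ((continuous_intervalIntegral_symm (hfc.norm.pow 2)).tendsto c).comp hlim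

/-- **Window values**: `b ↦ A_b(x)` is continuous for every `x`. [folklore] -/
theorem continuous_autocorrAt_radius (hfc : Continuous f) (x : ℝ) :
    Continuous fun b : ℝ ↦ autocorrAt b f x := by
  have hh : Continuous fun u : ℝ ↦ f u * conj (f (u - x)) :=
    hfc.mul (Complex.continuous_conj.comp (hfc.comp (continuous_id.sub continuous_const)))
  have hP : Continuous fun y : ℝ ↦ ∫ u in (0 : ℝ)..y, f u * conj (f (u - x)) :=
    intervalIntegral.continuous_primitive (fun a b ↦ hh.intervalIntegrable a b) 0
  have heq : (fun b : ℝ ↦ autocorrAt b f x) = fun b ↦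
      (∫ u in (0 : ℝ)..(overlapRight b x), f u * conj (f (u - x))) -
        ∫ u in (0 : ℝ)..(overlapLeft b x), f u * conj (f (u - x)) := by
    funext b
    rw [autocorrAt, cutoffAt, weilConv_weilReflect_cutoff_eq,
      intervalIntegral.integral_interval_sub_left (hh.intervalIntegrable _ _)
        (hh.intervalIntegrable _ _)]
  rw [heq]
  have hl : Continuous fun b : ℝ ↦ overlapLeft b x :=
    continuous_id.neg.max (continuous_const.sub continuous_id)
  have hr : Continuous fun b : ℝ ↦ overlapRight b x :=
    hl.max (continuous_id.min (continuous_const.add continuous_id))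
  exact (hP.comp hr).sub (hP.comp hl)

/-- `A_{b_n}(x) → A_c(x)`. [folklore] -/
theorem tendsto_autocorrAt_apply (hfc : Continuous f) {b : ℕ → ℝ} {c : ℝ}
    (hlim : Tendsto b atTop (𝓝 c)) (x : ℝ) :
    Tendsto (fun n ↦ autocorrAt (b n) f x) atTop (𝓝 (autocorrAt c f x)) :=
  ((continuous_autocorrAt_radius hfc x).tendsto c).comp hlim

/-- `F̂_{b_n}(s) → F̂_c(s)` (`b_n, c ≥ 0`). [folklore] -/
theorem tendsto_weilMellin_cutoffAt (hfc : Continuous f) {b : ℕ → ℝ} (hb : ∀ n, 0 ≤ b n)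
    {c : ℝ} (hc : 0 ≤ c) (hlim : Tendsto b atTop (𝓝 c)) (s : ℂ) :
    Tendsto (fun n ↦ weilMellin (cutoffAt (b n) f) s) atTop (𝓝 (weilMellin (cutoffAt c f) s)) := by
  have h1 : (fun n ↦ weilMellin (cutoffAt (b n) f) s) =
      fun n ↦ ∫ x in (-(b n))..(b n), f x * cexp ((s - 1 / 2) * x) :=
    funext fun n ↦ weilMellin_cutoffAt_eq f (hb n) s
  rw [h1, weilMellin_cutoffAt_eq f hc]
  exact ((continuous_intervalIntegral_symm (hfc.mul (by fun_prop))).tendsto c).comp hlim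

/-! ## §3 The prime and polar terms of `W(A_b)` -/

/-- `A_b(x) = 0` for `|x| > 2B ≥ 2b`. [folklore] -/
theorem autocorrAt_eq_zero_of_le (f : ℝ → ℂ) {b B x : ℝ} (hbB : b ≤ B) (hx : 2 * B < |x|) :
    autocorrAt b f x = 0 :=
  weilConv_weilReflect_cutoff_eq_zero f (by linarith)

/-- The prime term of `A_b` is ONE finite sum for all `b ≤ B`. [folklore] -/
theorem weilPrimeTerm_autocorrAt_eq_sum (f : ℝ → ℂ) {b B : ℝ} (hbB : b ≤ B) :
    weilPrimeTerm (autocorrAt b f) = ∑ n ∈ Finset.range ⌈Real.exp (2 * B + 1)⌉₊,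
      ((ArithmeticFunction.vonMangoldt n : ℝ) : ℂ) / (Real.sqrt n : ℂ) *
        (autocorrAt b f (Real.log n) + autocorrAt b f (-Real.log n)) :=
  WeilContinuous.weilPrimeTerm_eq_sum_of_support fun _ hu ↦ autocorrAt_eq_zero_of_le f hbB hu

/-- **Prime term**: `P(A_{b_n}) → P(A_c)` for `b_n, c ≤ B`. [folklore] -/
theorem tendsto_weilPrimeTerm_autocorrAt (hfc : Continuous f) {b : ℕ → ℝ} {B : ℝ}
    (hbB : ∀ n, b n ≤ B) {c : ℝ} (hcB : c ≤ B) (hlim : Tendsto b atTop (𝓝 c)) :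
    Tendsto (fun n ↦ weilPrimeTerm (autocorrAt (b n) f)) atTop
      (𝓝 (weilPrimeTerm (autocorrAt c f))) := by
  have h1 : (fun n ↦ weilPrimeTerm (autocorrAt (b n) f)) = fun n ↦
      ∑ m ∈ Finset.range ⌈Real.exp (2 * B + 1)⌉₊,
        ((ArithmeticFunction.vonMangoldt m : ℝ) : ℂ) / (Real.sqrt m : ℂ) *
          (autocorrAt (b n) f (Real.log m) + autocorrAt (b n) f (-Real.log m)) :=
    funext fun n ↦ weilPrimeTerm_autocorrAt_eq_sum f (hbB n)
  rw [h1, weilPrimeTerm_autocorrAt_eq_sum f hcB]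
  refine tendsto_finsetSum _ fun m _ ↦ ?_
  exact ((tendsto_autocorrAt_apply hfc hlim _).add (tendsto_autocorrAt_apply hfc hlim _)).const_mul _

/-- **Polar term**: `M(A_{b_n})(0) + M(A_{b_n})(1) → M(A_c)(0) + M(A_c)(1)`. [folklore] -/
theorem tendsto_weilPolarTerm_autocorrAt (hfc : Continuous f) {b : ℕ → ℝ} (hb : ∀ n, 0 ≤ b n)
    {c : ℝ} (hc : 0 ≤ c) (hlim : Tendsto b atTop (𝓝 c)) :
    Tendsto (fun n ↦ weilPolarTerm (autocorrAt (b n) f)) atTop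
      (𝓝 (weilPolarTerm (autocorrAt c f))) := by
  have hM := fun s ↦ tendsto_weilMellin_cutoffAt hfc hb hc hlim s
  have hconj : ∀ s : ℂ, Tendsto (fun n ↦ conj (weilMellin (cutoffAt (b n) f) s)) atTop
      (𝓝 (conj (weilMellin (cutoffAt c f) s))) :=
    fun s ↦ (Complex.continuous_conj.tendsto _).comp (hM s)
  simp only [weilPolarTerm, weilMellin_autocorrAt hfc]
  exact ((hM 0).mul (hconj _)).add ((hM 1).mul (hconj _))

/-! ## §4 Uniform decay of `F̂_b` on the critical line -/

/-- `F̂_b(½+it) = ∫_{-b}^{b} f(x) e^{itx} dx`. [folklore] -/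
theorem weilMellin_cutoffAt_half_eq (f : ℝ → ℂ) {b : ℝ} (hb : 0 ≤ b) (t : ℝ) :
    weilMellin (cutoffAt b f) (1 / 2 + t * I) = ∫ x in (-b)..b, f x * oscFactor t x := by
  rw [weilMellin_cutoffAt_eq f hb]
  congr 1; funext x
  simp only [oscFactor]
  congr 1; ring_nf

/-- `t ↦ F̂_b(½+it)` is continuous. [folklore] -/
theorem continuous_weilMellin_cutoffAt_half (hfc : Continuous f) {b : ℝ} (hb : 0 ≤ b) :
    Continuous fun t : ℝ ↦ weilMellin (cutoffAt b f) (1 / 2 + t * I) := by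
  have heq : (fun t : ℝ ↦ weilMellin (cutoffAt b f) (1 / 2 + t * I)) =
      fun t ↦ ∫ x in (-b)..b, f x * oscFactor t x := funext (weilMellin_cutoffAt_half_eq f hb)
  rw [heq]
  exact intervalIntegral.continuous_parametric_intervalIntegral_of_continuous'
    ((hfc.comp continuous_snd).mul continuous_oscFactor_uncurry) _ _

/-- **Uniform decay**: `‖F̂_b(½+it)‖ ≤ C/(1+|t|)` for all `b ∈ [0, B]`, `t ∈ ℝ`, for `f ∈ C¹`.
[folklore] -/
theorem exists_norm_weilMellin_cutoffAt_half_le (hf : ∀ x, HasDerivAt f (f' x) x)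
    (hf' : Continuous f') {B : ℝ} (hB : 0 ≤ B) :
    ∃ C : ℝ, 0 ≤ C ∧ ∀ b ∈ Icc 0 B, ∀ t : ℝ,
      ‖weilMellin (cutoffAt b f) (1 / 2 + t * I)‖ ≤ C / (1 + |t|) := by
  have hfc : Continuous f := continuous_iff_continuousAt.2 fun x ↦ (hf x).continuousAt
  have hBB : -B ≤ B := by linarith
  obtain ⟨M, hM⟩ := isCompact_Icc.exists_bound_of_continuousOn (s := Icc (-B) B) hfc.continuousOn
  set C₀ : ℝ := ∫ x in (-B)..B, ‖f x‖ with hC₀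
  set C₁ : ℝ := M + M + ∫ x in (-B)..B, ‖f' x‖ with hC₁
  have hM0 : 0 ≤ M := (norm_nonneg _).trans (hM 0 ⟨by linarith, hB⟩)
  have hC₀nn : 0 ≤ C₀ := intervalIntegral.integral_nonneg hBB fun x _ ↦ norm_nonneg _
  have hC₁nn : 0 ≤ C₁ := by
    have : 0 ≤ ∫ x in (-B)..B, ‖f' x‖ := intervalIntegral.integral_nonneg hBB fun x _ ↦ norm_nonneg _
    positivity
  refine ⟨2 * max C₀ C₁, by positivity, fun b hb t ↦ ?_⟩
  have hb0 : 0 ≤ b := hb.1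
  have hbb : -b ≤ b := by linarith
  rw [weilMellin_cutoffAt_half_eq f hb0]
  -- monotonicity of the nonnegative integrals in the radius
  have hmono : ∀ {h : ℝ → ℂ}, Continuous h →
      (∫ x in (-b)..b, ‖h x‖) ≤ ∫ x in (-B)..B, ‖h x‖ := fun hh ↦
    intervalIntegral.integral_mono_interval (by linarith [hb.2]) hbb hb.2
      (Eventually.of_forall fun x ↦ norm_nonneg _) (hh.norm.intervalIntegrable _ _)
  have h0 : ‖∫ x in (-b)..b, f x * oscFactor t x‖ ≤ C₀ :=
    (norm_intervalIntegral_mul_cexp_le_integral_norm hbb t).trans (hmono hfc)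
  have hpos : 0 < 1 + |t| := by positivity
  rw [le_div_iff₀ hpos]
  by_cases ht : |t| ≤ 1
  · calc ‖∫ x in (-b)..b, f x * oscFactor t x‖ * (1 + |t|) ≤ C₀ * 2 :=
          mul_le_mul h0 (by linarith) hpos.le hC₀nn
      _ ≤ 2 * max C₀ C₁ := by linarith [le_max_left C₀ C₁]
  · push Not at ht
    have ht0 : t ≠ 0 := by intro h; rw [h, abs_zero] at ht; linarith
    have h1 : ‖∫ x in (-b)..b, f x * oscFactor t x‖ ≤ C₁ / |t| := by
      refine (norm_intervalIntegral_mul_cexp_le hbb (fun x _ ↦ hf x) hf' ht0).trans ?_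
      refine div_le_div_of_nonneg_right ?_ (abs_nonneg t)
      have e1 : ‖f (-b)‖ ≤ M := hM _ ⟨by linarith [hb.2], by linarith⟩
      have e2 : ‖f b‖ ≤ M := hM _ ⟨by linarith, hb.2⟩
      linarith [hmono hf']
    have htpos : 0 < |t| := by linarith
    calc ‖∫ x in (-b)..b, f x * oscFactor t x‖ * (1 + |t|)
        ≤ C₁ / |t| * (1 + |t|) := by gcongr
      _ = C₁ * ((1 + |t|) / |t|) := by ring
      _ ≤ C₁ * 2 := by
          refine mul_le_mul_of_nonneg_left ?_ hC₁nn
          rw [div_le_iff₀ htpos]; linarith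
      _ ≤ 2 * max C₀ C₁ := by linarith [le_max_right C₀ C₁]

end Summit.RiemannHypothesis.RiemannHypothesis.Theorems.PfPersistence
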